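import Summits.AtomisticToContinuum.BoseEinsteinCondensation.Theorems.BECConjugateDominationTiltedCoherenceDefs
import Summits.AtomisticToContinuum.BoseEinsteinCondensation.Theorems.BECConjugateDominationPuffFloorPositiveMinimiser
import Summits.AtomisticToContinuum.BoseEinsteinCondensation.Theorems.BECConjugateDominationPuffFloorPositiveMinimiserUnique
import Summits.AtomisticToContinuum.BoseEinsteinCondensation.Theorems.BECConjugateDominationPuffFloorEulerLagrange

/-!
# Route `BECConjugateDomination`, crux `InfraredMinimumUncertainty` (stmt-AtomisticToContinuum-11784),
# line `tilted-coherence-work-variance`: the registered stub `stub_tiltedGeneratorIdentity` (S2)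

Supports (does not close) stmt-AtomisticToContinuum-11784.  **Every tilted state is an exact ground
state: the weak generator identity.**  For a smooth-class pair potential `v`, `L > 0` and a positive
minimiser `Ψ` of the periodic `(n+1)`-body energy, write `Ψ = e^{-U}` (`U = -log |Ψ|`), let
`τ_r X = (x₀ + r, x₁, …, x_n)` be the shift of the tagged particle, `δU_r = U∘τ_r − U` the work
(`work Ψ r`), `Φ_t = e^{-(U + t δU_r)} = |Ψ|^{1-t} |Ψ∘τ_r|^t` the geometric tilt and
`W = (∑_{i<j} v^per(xᵢ − xⱼ)).toReal`.  Then for every `t`, `r` and every `C¹` lattice-periodic real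
test function `η`,

`∫ (∇η · ∇δU_r) Φ_t² dX = ∫ η · [(W∘τ_r − W) − (1 − 2t)|∇δU_r|²] Φ_t² dX`

(`TiltedGeneratorIdentityAt v Ψ` of `Theorems/BECConjugateDominationTiltedCoherenceDefs.lean`), i.e.
`−L_t δU_r = (W∘τ_r − W) − (1 − 2t)|∇δU_r|²` weakly for the Langevin generator `L_t = Δ − 2∇U_t·∇`
of `μ_t ∝ Φ_t² dX`.

## Proof

* `Ψ` is `C³`: the `C³` positive minimiser of `stub_positiveMinimiser`
  (Theorems/BECConjugateDominationPuffFloorPositiveMinimiser) is the unique positive minimiser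
  (`stub_positiveMinimiserUnique`), hence equals `Ψ`.
* The real interaction `W` is finite and `C¹` for every `L > 0` (local finiteness of the
  periodisation, `PositiveMinimiserStub.contDiff_toReal_periodicInteraction_locFinite`), so the
  Euler–Lagrange equation `−ΔΨ + WΨ = E₀Ψ` holds pointwise
  (`PuffFloorEulerLagrange.eulerLagrange_pointwise`); read in `ℝ` (`Ψ = ofReal ∘ |Ψ|`) and divided
  by `|Ψ| = e^{-U} > 0` via the Riccati identity `Δe^{-U} = −(ΔU − |∇U|²)e^{-U}`
  (`configLaplacian_exp_neg`) it is `ΔU − |∇U|² = E₀ − W` (`localKinetic_negLog_eq`), and by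
  translation covariance the same holds for `U∘τ_r` with `W∘τ_r`.
* The policy-improvement identity `localKinetic_add` and `langevinGen_exp_neg`
  (Literature/…/LangevinGenerator) then give, pointwise,
  `L_{Φ_t} δU_r = ΔδU_r − 2∇(U + tδU_r)·∇δU_r = (W − W∘τ_r) + (1 − 2t)|∇δU_r|²`,
  and Green's identity on the torus (`integral_mul_langevinGen_mul_sq`,
  `∫ η (L_F ψ) F² = −∫ ∇η·∇ψ F²`) is the claim (`weak_identity`); `Φ_t² = tiltWeight` by
  `|Ψ|^{2(1−t)}|Ψ∘τ_r|^{2t} = e^{−2(1−t)U − 2tU∘τ_r}`.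

References: D. Bakry, I. Gentil, M. Ledoux, *Analysis and Geometry of Markov Diffusion Operators*
(2014), §1.11.3 (1.11.8)–(1.11.10) (generator and reversible measure of `Δ − ∇W·∇`, Green's
identity); M. Reed, B. Simon, *Methods of Modern Mathematical Physics IV* (1978), §XIII.12
(eigenvalue equation and uniqueness of the positive ground state); C. Jarzynski, Phys. Rev. Lett. 78
(1997) 2690 (tilted interpolation of measures).
-/

noncomputable section

open Literature.MathematicalPhysics.QuantumManyBody.BoseGas
open MeasureTheory Filter Set
open scoped ENNReal NNReal BigOperators

namespace Summit.AtomisticToContinuum.BoseEinsteinCondensation.Theorems.BECConjugateDomination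

open Summit.AtomisticToContinuum.BoseEinsteinCondensation.Cruxes.InfraredMinimumUncertainty.FisherGaussianDensityMode
open Summit.AtomisticToContinuum.BoseEinsteinCondensation.Cruxes.InfraredMinimumUncertainty.TiltedCoherenceWorkVariance

variable {n : ℕ} {L : ℝ}

namespace TiltedGeneratorIdentity

variable {N : ℕ}

/-- The coordinate unit vector `e_{i,a}` of `(ℝ³)^N` (particle `i`, axis `a`), local notation. -/
local notation3 "𝐞[" i ", " a "]" => (Pi.single i (EuclideanSpace.single a (1 : ℝ)) : Config _)

/-! ### Calculus: real parts and translations -/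

/-- `D(ofReal ∘ φ)(X) w = ofReal (Dφ(X) w)` at a point of differentiability. [folklore] -/
theorem fderiv_ofReal_comp_apply {φ : Config N → ℝ} {X : Config N} (hφ : DifferentiableAt ℝ φ X)
    (w : Config N) : fderiv ℝ (fun Y => ((φ Y : ℝ) : ℂ)) X w = ((fderiv ℝ φ X w : ℝ) : ℂ) := by
  rw [show (fun Y => ((φ Y : ℝ) : ℂ)) = (⇑Complex.ofRealCLM ∘ φ) from rfl,
    (Complex.ofRealCLM.hasFDerivAt.comp X hφ.hasFDerivAt).fderiv]
  rfl

/-- The complex coordinate Laplacian of `ofReal ∘ φ` is `ofReal` of the real one, for `φ ∈ C²`.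
[folklore] -/
theorem configLaplacian_ofReal {φ : Config N → ℝ} (hφ : ContDiff ℝ 2 φ) (X : Config N) :
    (∑ i : Fin N, ∑ a : Fin 3,
        fderiv ℝ (fun Y => fderiv ℝ (fun Z => ((φ Z : ℝ) : ℂ)) Y 𝐞[i, a]) X 𝐞[i, a]) =
      ((configLaplacian φ X : ℝ) : ℂ) := by
  have hφd : Differentiable ℝ φ := hφ.differentiable two_ne_zero
  have hinner : ∀ (i : Fin N) (a : Fin 3),
      (fun Y => fderiv ℝ (fun Z => ((φ Z : ℝ) : ℂ)) Y 𝐞[i, a]) =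
        fun Y => ((pderiv i a φ Y : ℝ) : ℂ) :=
    fun i a => funext fun Y => fderiv_ofReal_comp_apply (hφd Y) _
  rw [configLaplacian, Complex.ofReal_sum]
  refine Finset.sum_congr rfl fun i _ => ?_
  rw [Complex.ofReal_sum]
  refine Finset.sum_congr rfl fun a _ => ?_
  rw [hinner, fderiv_ofReal_comp_apply (differentiable_pderiv hφ i a X)]
  rfl

/-- `∂_{i,k}` commutes with translations: `∂_{i,k}(φ(· + c))(X) = (∂_{i,k}φ)(X + c)`. [folklore] -/
theorem pderiv_comp_add (φ : Config N → ℝ) (c X : Config N) (i : Fin N) (k : Fin 3) :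
    pderiv i k (fun Y => φ (Y + c)) X = pderiv i k φ (X + c) := by
  unfold pderiv
  rw [fderiv_comp_add_right]

/-- The local kinetic energy `ΔS − |∇S|²` commutes with translations. [folklore] -/
theorem localKinetic_comp_add (φ : Config N → ℝ) (c X : Config N) :
    localKinetic (fun Y => φ (Y + c)) X = localKinetic φ (X + c) := by
  have h1 : ∀ (i : Fin N) (k : Fin 3),
      pderiv i k (fun Y => φ (Y + c)) = fun Y => pderiv i k φ (Y + c) :=
    fun i k => funext fun Y => pderiv_comp_add φ c Y i k
  simp only [localKinetic, configLaplacian, gradDot, h1, pderiv_comp_add]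

/-! ### The Euler–Lagrange equation in logarithmic variables -/

/-- For a real nowhere-vanishing state, `|Ψ|` is the real part of `Ψ`, hence as smooth as `Ψ`.
[folklore] -/
theorem contDiff_norm_of_real {m : WithTop ℕ∞} (Ψ : PeriodicTrialState N L)
    (hC : ContDiff ℝ m Ψ.ψ) (hreal : ∀ X, Ψ.ψ X = (‖Ψ.ψ X‖ : ℂ)) :
    ContDiff ℝ m fun X => ‖Ψ.ψ X‖ := by
  have h : (fun X => ‖Ψ.ψ X‖) = fun X => (Ψ.ψ X).re := funext fun X => by
    conv_rhs => rw [hreal X]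
    exact (Complex.ofReal_re _).symm
  rw [h]
  exact Complex.reCLM.contDiff.comp hC

/-- `U = -log |Ψ|` is `C³` for a `C³` real nowhere-vanishing state. [folklore] -/
theorem contDiff_negLog (Ψ : PeriodicTrialState N L) (hC3 : ContDiff ℝ 3 Ψ.ψ)
    (hreal : ∀ X, Ψ.ψ X = (‖Ψ.ψ X‖ : ℂ)) (hne : ∀ X, Ψ.ψ X ≠ 0) :
    ContDiff ℝ 3 fun X => -Real.log ‖Ψ.ψ X‖ :=
  ((contDiff_norm_of_real Ψ hC3 hreal).log fun X => (norm_pos_iff.2 (hne X)).ne').neg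

/-- **The eigenvalue equation in logarithmic variables.** For a `C³`, real, nowhere-vanishing
exact minimiser `Ψ = e^{-U}` (`U = -log |Ψ|`) of the periodic `N`-body energy whose interaction is
`ofReal` of a `C¹` real `V ≥ 0`: `ΔU − |∇U|² = E₀ − V` pointwise — the Riccati form of
`−ΔΨ + VΨ = E₀Ψ` (`PuffFloorEulerLagrange.eulerLagrange_pointwise`), read in `ℝ` and divided by
`|Ψ| > 0` (`configLaplacian_exp_neg`). [folklore] -/
theorem localKinetic_negLog_eq (hL : 0 < L) {v : ℝ → ℝ≥0∞} {V : Config N → ℝ}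
    (hV : ContDiff ℝ 1 V) (hV0 : ∀ X, 0 ≤ V X)
    (hW : ∀ X : Config N, periodicInteraction v L X = ENNReal.ofReal (V X))
    (Ψ : PeriodicTrialState N L) (hC3 : ContDiff ℝ 3 Ψ.ψ)
    (hmin : periodicEnergy v Ψ = periodicGroundStateEnergy v N L) (hfin : periodicEnergy v Ψ ≠ ⊤)
    (hreal : ∀ X, Ψ.ψ X = (‖Ψ.ψ X‖ : ℂ)) (hne : ∀ X, Ψ.ψ X ≠ 0) (X : Config N) :
    localKinetic (fun Y => -Real.log ‖Ψ.ψ Y‖) X =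
      (periodicGroundStateEnergy v N L).toReal - V X := by
  have hpos : ∀ Y, 0 < ‖Ψ.ψ Y‖ := fun Y => norm_pos_iff.2 (hne Y)
  have hψ3 : ContDiff ℝ 3 fun Y => ‖Ψ.ψ Y‖ := contDiff_norm_of_real Ψ hC3 hreal
  have hψ2 : ContDiff ℝ 2 fun Y => ‖Ψ.ψ Y‖ := hψ3.of_le (by norm_num)
  have hU2 : ContDiff ℝ 2 fun Y => -Real.log ‖Ψ.ψ Y‖ :=
    (contDiff_negLog Ψ hC3 hreal hne).of_le (by norm_num)
  have hfun : Ψ.ψ = fun Y => ((‖Ψ.ψ Y‖ : ℝ) : ℂ) := funext hreal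
  -- the Euler–Lagrange equation, read in `ℝ`
  have hEL := PuffFloorEulerLagrange.eulerLagrange_pointwise hL hV hV0 hW Ψ hC3 hmin hfin X
  have hlap : (∑ i : Fin N, ∑ a : Fin 3,
      fderiv ℝ (fun Y => fderiv ℝ Ψ.ψ Y 𝐞[i, a]) X 𝐞[i, a]) =
        ((configLaplacian (fun Y => ‖Ψ.ψ Y‖) X : ℝ) : ℂ) := by
    rw [← configLaplacian_ofReal hψ2 X, ← hfun]
  rw [hlap, hreal X] at hEL
  have hreal_eq : -configLaplacian (fun Y => ‖Ψ.ψ Y‖) X + V X * ‖Ψ.ψ X‖ =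
      (periodicGroundStateEnergy v N L).toReal * ‖Ψ.ψ X‖ := by
    exact_mod_cast hEL
  -- `|Ψ| = e^{-U}` and the Riccati identity `Δ e^{-U} = -(ΔU - |∇U|²) e^{-U}`
  have hexp : (fun Y => Real.exp (-(-Real.log ‖Ψ.ψ Y‖))) = fun Y => ‖Ψ.ψ Y‖ :=
    funext fun Y => by rw [neg_neg, Real.exp_log (hpos Y)]
  have hRic := configLaplacian_exp_neg hU2 X
  rw [hexp, neg_neg, Real.exp_log (hpos X)] at hRic
  rw [hRic] at hreal_eq
  have hprod : (localKinetic (fun Y => -Real.log ‖Ψ.ψ Y‖) X -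
      ((periodicGroundStateEnergy v N L).toReal - V X)) * ‖Ψ.ψ X‖ = 0 := by
    linear_combination hreal_eq
  exact sub_eq_zero.1 ((mul_eq_zero.1 hprod).resolve_right (hpos X).ne')

/-- The periodic interaction of a finite, finite-range profile is finite at every configuration,
for every `L ≠ 0` (no nearest-image restriction). [folklore] -/
theorem periodicInteraction_ne_top_locFinite {v : ℝ → ℝ≥0∞} {R₀ L : ℝ} (hfin : ∀ r, v r ≠ ⊤)
    (hR : ∀ r, R₀ < r → v r = 0) (hL : L ≠ 0) (X : Config N) :
    periodicInteraction v L X ≠ ⊤ := by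
  unfold periodicInteraction
  exact ENNReal.sum_ne_top.2 fun i _ => ENNReal.sum_ne_top.2 fun j _ =>
    PositiveMinimiserStub.periodizedPotential_ne_top_of_finiteRange hfin hR hL _

/-! ### The weak generator identity of the tilt family, abstract form -/

/-- **The tilted generator identity, abstract form.** Let `U ∈ C³` be lattice periodic with
`ΔU − |∇U|² = E − W` pointwise (the eigen-equation of `e^{-U}` in logarithmic variables), let
`τ = (· + c)` be a translation, `w = U∘τ − U` the work, `F_t = e^{−(U + t w)}` the tilt and
`ρ = F_t²` its density.  Translation covariance gives `ΔU∘τ − |∇U∘τ|² = E − W∘τ`, the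
policy-improvement identity `localKinetic_add` and `langevinGen_exp_neg` give
`L_{F_t} w = (W − W∘τ) + (1 − 2t)|∇w|²` pointwise, and Green's identity on the torus
(`integral_mul_langevinGen_mul_sq`) gives, for every periodic test function `η`,
`∫ ∇η·∇w ρ = ∫ η [(W∘τ − W) − (1 − 2t)|∇w|²] ρ`. [folklore] -/
theorem weak_identity (hL : 0 < L) {U : Config N → ℝ} (hU : ContDiff ℝ 3 U)
    (hUper : IsLatticePeriodic L U) {W : Config N → ℝ} {E : ℝ}
    (hkin : ∀ X, localKinetic U X = E - W X) {c : Config N} {τ : Config N → Config N}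
    (hτ : ∀ X, τ X = X + c) (t : ℝ) {η : Config N → ℝ} (hη : IsPeriodicTest L η)
    {w : Config N → ℝ} (hw : ∀ X, w X = U (τ X) - U X) {ρ : Config N → ℝ}
    (hρ : ∀ X, ρ X = Real.exp (-(U X + t * w X)) ^ 2) :
    (∫ X in cellN N L, (∑ i : Fin N, ∑ k : Fin 3,
        fderiv ℝ η X 𝐞[i, k] * fderiv ℝ w X 𝐞[i, k]) * ρ X) =
      ∫ X in cellN N L, η X * ((W (τ X) - W X) -
        (1 - 2 * t) * ∑ i : Fin N, ∑ k : Fin 3, (fderiv ℝ w X 𝐞[i, k]) ^ 2) * ρ X := by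
  -- the translate `U ∘ τ` and the work `w = U ∘ τ - U`
  obtain ⟨Ur, hUr⟩ : ∃ Ur : Config N → ℝ, Ur = fun X => U (X + c) := ⟨_, rfl⟩
  have hwfun : w = Ur - U := funext fun X => by rw [Pi.sub_apply, hw, hτ, hUr]
  have hU2 : ContDiff ℝ 2 U := hU.of_le (by norm_num)
  have hUd : Differentiable ℝ U := hU.differentiable (by norm_num)
  have hUr3 : ContDiff ℝ 3 Ur := hUr ▸ hU.comp (contDiff_id.add contDiff_const)
  have hw3 : ContDiff ℝ 3 w := hwfun ▸ hUr3.sub hU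
  have hw2 : ContDiff ℝ 2 w := hw3.of_le (by norm_num)
  have hwd : Differentiable ℝ w := hw3.differentiable (by norm_num)
  -- the tilt `F = e^{-S}`, `S = U + t w`
  obtain ⟨S, hS⟩ : ∃ S : Config N → ℝ, S = fun X => U X + t * w X := ⟨_, rfl⟩
  obtain ⟨F, hF⟩ : ∃ F : Config N → ℝ, F = fun X => Real.exp (-S X) := ⟨_, rfl⟩
  have hS3 : ContDiff ℝ 3 S := hS ▸ hU.add (contDiff_const.mul hw3)
  have hF1 : ContDiff ℝ 1 F := hF ▸ hS3.neg.exp.of_le (by norm_num)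
  have hF0 : ∀ X, F X ≠ 0 := fun X => by rw [hF]; exact (Real.exp_pos _).ne'
  have hρF : ∀ X, ρ X = F X ^ 2 := fun X => by rw [hρ, hF, hS]
  -- periodicity
  have hUrper : IsLatticePeriodic L Ur := fun X i k => by
    rw [hUr]
    dsimp only
    rw [add_right_comm, hUper]
  have hwper : IsLatticePeriodic L w := by
    rw [hwfun, sub_eq_add_neg]
    exact hUrper.add hUper.neg
  have hSper : IsLatticePeriodic L S := fun X i k => by
    rw [hS]
    dsimp only
    rw [hUper, hwper]
  have hFper : IsLatticePeriodic L F := fun X i k => by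
    rw [hF]
    exact congrArg (fun s => Real.exp (-s)) (hSper X i k)
  -- the eigen-equation at the translate, and the pointwise generator identity
  have hkinUr : ∀ X, localKinetic Ur X = E - W (X + c) := fun X => by
    rw [hUr, localKinetic_comp_add]
    exact hkin (X + c)
  have hgen : ∀ X, langevinGen F w X = (W X - W (τ X)) + (1 - 2 * t) * gradDot w w X := by
    intro X
    have h1 := localKinetic_add hU2 hw2 X
    have hUw : U + w = Ur := by rw [hwfun]; abel
    rw [hUw, hkinUr, hkin, langevinGen_exp_neg] at h1
    have h2 : langevinGen F w X = configLaplacian w X - 2 * gradDot S w X := by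
      rw [hF]
      exact langevinGen_exp_neg S w X
    have hSfun : S = U + t • w := by
      rw [hS]
      funext Y
      simp [smul_eq_mul]
    have hd : DifferentiableAt ℝ (t • w) X := (hwd.const_smul t) X
    have h3 : gradDot S w X = gradDot U w X + t * gradDot w w X := by
      rw [hSfun, gradDot_add_left (hUd X) hd w, gradDot_smul_left]
    rw [h2, h3, hτ]
    linear_combination (-1 : ℝ) * h1
  -- Green's identity on the torus
  have hGreen := integral_mul_langevinGen_mul_sq hL hF1 hFper hF0 hη hw2 hwper
  have hlhs : (∫ X in cellN N L, (∑ i : Fin N, ∑ k : Fin 3,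
      fderiv ℝ η X 𝐞[i, k] * fderiv ℝ w X 𝐞[i, k]) * ρ X) = dirichletFormW L F η w := by
    rw [dirichletFormW_def]
    refine integral_congr_ae (Filter.Eventually.of_forall fun X => ?_)
    simp only [hρF X, gradDot, pderiv]
  have hrhs : (∫ X in cellN N L, η X * ((W (τ X) - W X) -
      (1 - 2 * t) * ∑ i : Fin N, ∑ k : Fin 3, (fderiv ℝ w X 𝐞[i, k]) ^ 2) * ρ X) =
        -∫ X in cellN N L, η X * langevinGen F w X * F X ^ 2 := by
    rw [← integral_neg]
    refine integral_congr_ae (Filter.Eventually.of_forall fun X => ?_)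
    simp only [hρF X, hgen X, gradDot_self_eq_sum_sq]
    ring
  rw [hlhs, hrhs, hGreen, neg_neg]

/-! ### The line objects in terms of `U = -log |Ψ|` -/

/-- `τ_r X = X + e₀ ⊗ r`: shifting the tagged particle is translating by `Pi.single 0 r`.
[folklore] -/
theorem shiftFirst_eq_add_single (r : Space) (X : Config (n + 1)) :
    shiftFirst r X = X + Pi.single 0 r :=
  update_eq_add_single X 0 r

/-- The work in logarithmic variables: `δU_r = U∘τ_r − U`, `U = -log |Ψ|`. [folklore] -/
theorem work_eq (Ψ : PeriodicTrialState (n + 1) L) (r : Space) (X : Config (n + 1)) :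
    work Ψ r X = -Real.log ‖Ψ.ψ (shiftFirst r X)‖ - -Real.log ‖Ψ.ψ X‖ := by
  rw [work]
  ring

/-- The tilt weight is the square of the tilt: `|Ψ|^{2(1−t)} |Ψ∘τ_r|^{2t} = (e^{−(U + t δU_r)})²`
for a nowhere-vanishing state. [folklore] -/
theorem tiltWeight_eq (Ψ : PeriodicTrialState (n + 1) L) (hne : ∀ X, Ψ.ψ X ≠ 0) (t : ℝ)
    (r : Space) (X : Config (n + 1)) :
    tiltWeight Ψ t r X = Real.exp (-(-Real.log ‖Ψ.ψ X‖ + t * work Ψ r X)) ^ 2 := by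
  have h1 : 0 < ‖Ψ.ψ X‖ := norm_pos_iff.2 (hne X)
  have h2 : 0 < ‖Ψ.ψ (shiftFirst r X)‖ := norm_pos_iff.2 (hne _)
  rw [tiltWeight, work, Real.rpow_def_of_pos h1, Real.rpow_def_of_pos h2, ← Real.exp_add, sq,
    ← Real.exp_add]
  congr 1
  ring

end TiltedGeneratorIdentity

open TiltedGeneratorIdentity in
/-- **S2 `stub_tiltedGeneratorIdentity`** (registered signature, verbatim): for every smooth-class
`v`, every `L > 0` and every positive minimiser `Ψ` of the periodic `(n+1)`-body energy, the weak
generator identity of the tilt family `TiltedGeneratorIdentityAt v Ψ` holds: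
`∫ (∇η · ∇δU_r) Φ_t² = ∫ η · [(W∘τ_r − W) − (1 − 2t)|∇δU_r|²] Φ_t²` for all `t ∈ [0,1]`, `r`, and
`C¹` lattice-periodic real `η` (in fact for every real `t`).  Proof: `Ψ ∈ C³` is the unique positive
minimiser (`stub_positiveMinimiser`, `stub_positiveMinimiserUnique`); its Euler–Lagrange equation
(`PuffFloorEulerLagrange.eulerLagrange_pointwise`) in logarithmic variables `U = -log |Ψ|` reads
`ΔU − |∇U|² = E₀ − W`, likewise for `U∘τ_r` with `W∘τ_r`; hence
`L_{Φ_t} δU_r = (W − W∘τ_r) + (1 − 2t)|∇δU_r|²` pointwise (`localKinetic_add`,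
`langevinGen_exp_neg`), and Green's identity on the torus (`integral_mul_langevinGen_mul_sq`,
Bakry–Gentil–Ledoux (1.11.9)) is the claim. -/
theorem stub_tiltedGeneratorIdentity :
    ∀ v : ℝ → ℝ≥0∞, InSmoothClass v → ∀ (n : ℕ) (L : ℝ), 0 < L →
      ∀ Ψ : PeriodicTrialState (n + 1) L, IsPositiveMinimiser v Ψ → TiltedGeneratorIdentityAt v Ψ := by
  intro v hv n L hL Ψ hΨ t _ht r η hη hηper
  obtain ⟨hvR, hfin, hC2, hedge⟩ := hv
  obtain ⟨hmin, hfinE, hreal, hne⟩ := hΨ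
  obtain ⟨R₀, hR₀⟩ := hvR.2
  -- (1) `Ψ` is the `C³` positive minimiser
  obtain ⟨Ψ₀, hE₀, -, hC3₀, hreal₀, hne₀⟩ := stub_positiveMinimiser v hvR hfin hC2 hedge n L hL
  have heq : Ψ = Ψ₀ :=
    stub_positiveMinimiserUnique v hvR.1 n L hL Ψ Ψ₀ hmin hfinE hreal hne hE₀ hreal₀ hne₀
  have hC3 : ContDiff ℝ 3 Ψ.ψ := by
    rw [heq]
    exact hC3₀
  -- (2) the real interaction `W = (∑ v^per).toReal` is finite and `C¹`, for every `L > 0`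
  have hWne : ∀ X : Config (n + 1), periodicInteraction v L X ≠ ⊤ :=
    periodicInteraction_ne_top_locFinite hfin hR₀ hL.ne'
  have hW1 : ContDiff ℝ 1 fun X : Config (n + 1) => (periodicInteraction v L X).toReal :=
    PositiveMinimiserStub.contDiff_toReal_periodicInteraction_locFinite hfin hR₀ hL.ne'
      (hC2.of_le (by norm_num))
  have hWof : ∀ X : Config (n + 1),
      periodicInteraction v L X = ENNReal.ofReal (periodicInteraction v L X).toReal :=
    fun X => (ENNReal.ofReal_toReal (hWne X)).symm
  -- (3) the eigen-equation in logarithmic variables `U = -log |Ψ|`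
  have hkin : ∀ X, localKinetic (fun Y => -Real.log ‖Ψ.ψ Y‖) X =
      (periodicGroundStateEnergy v (n + 1) L).toReal - (periodicInteraction v L X).toReal :=
    fun X => localKinetic_negLog_eq hL hW1 (fun _ => ENNReal.toReal_nonneg) hWof Ψ hC3 hmin hfinE
      hreal hne X
  have hU3 : ContDiff ℝ 3 fun Y => -Real.log ‖Ψ.ψ Y‖ := contDiff_negLog Ψ hC3 hreal hne
  have hUper : IsLatticePeriodic L fun Y => -Real.log ‖Ψ.ψ Y‖ := fun X i k => by
    simp only [Ψ.periodic X i k]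
  -- (4) the abstract weak identity, with `τ = τ_r`, `w = δU_r`, `ρ = Φ_t²`
  exact weak_identity (W := fun Y => (periodicInteraction v L Y).toReal) hL hU3 hUper hkin
    (shiftFirst_eq_add_single r) t ⟨hη, hηper⟩ (work_eq Ψ r) (tiltWeight_eq Ψ hne t r)

end Summit.AtomisticToContinuum.BoseEinsteinCondensation.Theorems.BECConjugateDomination

end
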